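import Summits.CriticalPhenomena.SAWScalingLimit.Theorems.SAWRenewalTightnessSubseqIdentificationTiltedOneStep
import Summits.CriticalPhenomena.SAWScalingLimit.Theorems.SAWRenewalTightnessSubseqIdentificationTiltedEnvelope
import HarnessLib

/-!
# The tilted martingale identities (line `boundary-area-law`, RS5b′/T2): the frozen one-step estimates

Line `boundary-area-law` of the crux `SubseqIdentification` (stmt-CriticalPhenomena-0783), restriction
reshape (lead c4), stub `stub_tiltedMartingales` = step (T2) of the tilted [LSW] Theorem 6.5
(G. F. Lawler, O. Schramm, W. Werner, *Conformal restriction: the chordal case*, J. Amer. Math. Soc.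
**16** (2003), §5 (5.1)–(5.3) and Prop. 5.3). Third helper file, sub-step T2b of `RS5b-PLAN.md`:
**the one-step estimates of the mixed term, conditionally on the past** (the past frozen at time
`u`, `υ = concat_u(stop_u β(ω), β(ω₂))`, the future `ω₂` a fresh Brownian motion).

For a past alive at `u` with `B = A_u − W_u` in the controlled class (`2δ₀ ≤ Φ′_B(0)`, `B(0,16ρ₀)`
off `B`, `ρ₀ ≤ 1`) and driver bounded by `N` on `[0, u]`, a step `h ≤ 3c₀²/256` (`c₀ = δ₀ρ₀/4000`),
and exponents `α′ > 0`, `λ′ ≥ 0` with `λ′ h M_m ≤ 1`, writing `ΔW̃ = imageDrvFnK κ A (u+h) υ − imageDrvFnK κ A u υ`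
and `Ŷ′ = D_{u+h}(υ)^{α′} e^{−λ′ ∫ᵤ^{u+h} m(υ)}`:

* `frozen_prod_good` — on the good event `{σ sup_{[0,h]}|B(ω₂)| ≤ c₀}` the product `ΔW̃ · Ŷ′` is
  `6α′ d^{α′} c₂ h + imageDriverModel (d^{α′+1}) (d^{α′} c₂ (1+2α′)) h x + O(hη + h² + |x|³ + h|x|)`
  (the product expansion `hK` of `exists_abs_prod_sub_model_le` on top of the two deterministic one-step expansions of the tree,
  `abs_imageDriverStep_sub_model_le_of_mem_goodEventK` and `abs_compensatedStep_le`);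
* `frozen_prod_bad` — everywhere `|ΔW̃ · Ŷ′ − 6α′d^{α′}c₂h| ≤ (3482N + 15080√(u+h) + 1160R + 6α′/ρ₀) + 3482√κ sup|B(ω₂)|`;
* `frozen_prod_integral_sub_le` — **`E_{ω₂}[ΔW̃ · Ŷ′] = h d^{α′} c₂ (κ/2 − 3 + κα′) + O(h√h)`**
  (`abs_integral_sub_drift_le` of `SLEImageDriverOneStep` applied to `ΔW̃ · Ŷ′ − 6α′d^{α′}c₂h`); for
  `α′ = α = (6−κ)/(2κ)` the coefficient vanishes — this is `d⟨W̃, Y⟩ + Y · (drift of W̃) = 0`;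
* `frozen_prod_sq_integral_sub_le` — `E_{ω₂}[(ΔW̃ · Ŷ′ − 6α′d^{α′}c₂h)²] = κ d² d^{2α′} h + O(h√h)`
  (`abs_integral_sq_sub_le`), used with `(α′, λ′) = (α/2, λ/2)` (`Ŷ′_{α/2,λ/2}² = Ŷ′_{α,λ}`) for the
  bracket identity.

References: [LSW] §5 (5.1)–(5.3), Prop. 5.3. No named fact is used. -/

noncomputable section

open MeasureTheory Filter Topology Set Metric Function
open scoped NNReal ENNReal
open Literature.Probability.RandomPlanarGeometry
open Literature.Probability.Process (preWienerMeasure runSup runSup_nonneg integrable_runSup integrable_runSup_sq)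

namespace Summit.CriticalPhenomena.SAWScalingLimit.Theorems.SubseqIdentification.BoundaryAreaLaw

open Loewner PathOps

variable [MeasurableSpace C(ℝ≥0, ℝ)] [BorelSpace C(ℝ≥0, ℝ)]

section Frozen

variable {κ : ℝ≥0} {A : Set ℂ} {u h : ℝ≥0} {ω : ℝ≥0 → ℝ} {δ₀ ρ₀ R N : ℝ}
  (hκ0 : 0 < κ) (hκ : κ ≤ 8 / 3) (hA : IsStarHull A) (hne : A.Nonempty)
  (hR0 : 0 < R) (hAR : A ⊆ closedBall (0 : ℂ) R)
  (halive : Disjoint (closedHull (drvK κ (brownianCPath ω)) u) A) (hρ₀ : 0 < ρ₀) (hρ1 : ρ₀ ≤ 1)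
  (hBρ : Disjoint (ball (0 : ℂ) (16 * ρ₀)) (slidHull (drvK κ (brownianCPath ω)) A u))
  (hδ0 : 0 < δ₀) (hδ : 2 * δ₀ ≤ starDeriv (slidHull (drvK κ (brownianCPath ω)) A u)) (hh0 : 0 < h)
  (hh : (h : ℝ) ≤ 3 * (δ₀ * ρ₀ / 4000) ^ 2 / 256)
  (hN0 : 0 ≤ N) (hN : ∀ s : ℝ≥0, s ≤ u → |drvK κ (brownianCPath ω) s| ≤ N)

omit [MeasurableSpace C(ℝ≥0, ℝ)] [BorelSpace C(ℝ≥0, ℝ)] in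
include hκ0 hκ hρ₀ hρ1 hδ0 hδ hh in
/-- **Smallness.** With `c₀ = δ₀ρ₀/4000` and `c = c₀√κ/σ`: `h ≤ c₀²/32`, `32h ≤ c₀²`, `32κh ≤ c²`, `h ≤ 1`,
`0 < c ≤ 1`, `δ₀ ≤ 1`. [folklore] -/
theorem frozen_smallnessK :
    (h : ℝ) ≤ (δ₀ * ρ₀ / 4000) ^ 2 / 32 ∧ 32 * (h : ℝ) ≤ (δ₀ * ρ₀ / 4000) ^ 2 ∧
      32 * (κ : ℝ) * h ≤ (δ₀ * ρ₀ / 4000 * (Real.sqrt κ / stepSigma)) ^ 2 ∧ (h : ℝ) ≤ 1 ∧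
      0 < δ₀ * ρ₀ / 4000 * (Real.sqrt κ / stepSigma) ∧ δ₀ * ρ₀ / 4000 * (Real.sqrt κ / stepSigma) ≤ 1 ∧ δ₀ ≤ 1 := by
  have hd1 := (starDeriv_pos_le_one (slidHull (drvK κ (brownianCPath ω)) A u)).2
  have hδ1 : δ₀ ≤ 1 := by linarith
  have hκ' : (0 : ℝ) < κ := by exact_mod_cast hκ0
  have hκ83 : (κ : ℝ) ≤ 8 / 3 := by exact_mod_cast hκ
  have hs : 0 < Real.sqrt κ := Real.sqrt_pos.2 hκ'
  have hσ := stepSigma_pos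
  have hc0 : 0 < δ₀ * ρ₀ / 4000 := by positivity
  have hc1 : δ₀ * ρ₀ / 4000 ≤ 1 / 4000 := by
    rw [div_le_div_iff_of_pos_right (by norm_num)]
    have := mul_le_mul hδ1 hρ1 hρ₀.le zero_le_one
    linarith
  have hratio : Real.sqrt κ / stepSigma ≤ 1 := by rw [div_le_one hσ]; exact sqrt_le_stepSigma hκ
  have hratio0 : 0 < Real.sqrt κ / stepSigma := by positivity
  have hh0' : (0 : ℝ) ≤ h := h.coe_nonneg
  have hsq : (δ₀ * ρ₀ / 4000 * (Real.sqrt κ / stepSigma)) ^ 2 = (δ₀ * ρ₀ / 4000) ^ 2 * (κ * (3 / 8)) := by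
    rw [mul_pow, div_pow, div_pow, Real.sq_sqrt hκ'.le, stepSigma_sq]; ring
  refine ⟨by nlinarith, by nlinarith, ?_, ?_, by positivity, ?_, hδ1⟩
  · rw [hsq]
    have := mul_le_mul_of_nonneg_left hh (by positivity : (0 : ℝ) ≤ 32 * κ)
    nlinarith
  · have : (δ₀ * ρ₀ / 4000) ^ 2 ≤ 1 := by nlinarith
    nlinarith
  · have : δ₀ * ρ₀ / 4000 * (Real.sqrt κ / stepSigma) ≤ 1 / 4000 * 1 := mul_le_mul hc1 hratio hratio0.le (by norm_num)
    linarith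
include hκ0 hκ hA hne halive hρ₀ hρ1 hBρ hδ0 hδ hh0 hh in
set_option maxHeartbeats 800000 in -- buildfix 2026-08-19 (class ii): >200k in hub lake build
/-- **The product on the good event.** For `ω₂ ∈ {σ sup_{[0,h]}|B| ≤ c₀}` and `α′ > 0`, `λ′ ≥ 0` with
`λ′ h M_m ≤ 1`: `|ΔW̃ · Ŷ′ − 6α′ d^{α′} c₂ h − imageDriverModel (d · d^{α′}) (d^{α′} c₂ (1 + 2α′)) h x| ≤ K · r`,
`x = √κ B_h(ω₂)`, `r = h · stepSize (√κ sup|B|) h + h² + |x|³ + h|x|`, `d = Φ′_B(0)`, `c₂ = E_B″(0)`,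
`K` any constant of the deterministic product expansion `exists_abs_prod_sub_model_le` (with `K₁ = stepK δ₀ ρ₀`, `K₂ = compK α′ λ′ δ₀ ρ₀ · σ/√κ`). [cite: LawlerSchrammWerner2003Restriction, §5 (5.1)–(5.3) and Prop. 5.3] -/
theorem frozen_prod_good {α' lam' : ℝ} (hα' : 0 < α') (hlam' : 0 ≤ lam') (hlamh : lam' * (h * massBound δ₀ ρ₀) ≤ 1)
    {K : ℝ}
    (hK : ∀ {d c₂ c₃ m x ZM Yh r : ℝ} {u : ℝ≥0}, δ₀ ≤ d → d ≤ 1 →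
      |c₂| ≤ 1 / ρ₀ → |c₃| ≤ 2 / ρ₀ ^ 2 → |m| ≤ massBound δ₀ ρ₀ → |x| ≤ 1 → (u : ℝ) ≤ 1 → 0 ≤ Yh → Yh ≤ 1 →
      (u : ℝ) ^ 2 ≤ r → |x| ^ 3 ≤ r → u * |x| ≤ r →
      |ZM - imageDriverModel d c₂ u x| ≤ stepK δ₀ ρ₀ * r →
      |Yh - d ^ α' - (stepModelK α' d c₂ c₃ u x - lam' * u * m * d ^ α')| ≤ compK α' lam' δ₀ ρ₀ * (stepSigma / Real.sqrt κ) * r →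
      |ZM * Yh - 6 * α' * d ^ α' * c₂ * u - imageDriverModel (d * d ^ α') (d ^ α' * c₂ * (1 + 2 * α')) u x| ≤ K * r)
    {ω₂ : ℝ≥0 → ℝ} (hω₂ : ω₂ ∈ Literature.Probability.RandomPlanarGeometry.goodEvent δ₀ ρ₀ h) :
    |(imageDrvFnK κ A (u + h) (concat u (stop u (brownianCPath ω), brownianCPath ω₂)) -
            imageDrvFnK κ A u (concat u (stop u (brownianCPath ω), brownianCPath ω₂))) *
          (DFnK κ A (u + h) (concat u (stop u (brownianCPath ω), brownianCPath ω₂)) ^ α' *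
            Real.exp (-(lam' * JFnK κ A u h (concat u (stop u (brownianCPath ω), brownianCPath ω₂))))) -
        6 * α' * starDeriv (slidHull (drvK κ (brownianCPath ω)) A u) ^ α' * starJet2 (slidHull (drvK κ (brownianCPath ω)) A u) * h -
        imageDriverModel (starDeriv (slidHull (drvK κ (brownianCPath ω)) A u) * starDeriv (slidHull (drvK κ (brownianCPath ω)) A u) ^ α')
          (starDeriv (slidHull (drvK κ (brownianCPath ω)) A u) ^ α' * starJet2 (slidHull (drvK κ (brownianCPath ω)) A u) * (1 + 2 * α'))
          h (stepDriverK κ ω₂ h)| ≤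
      K *
        (h * stepSize (Real.sqrt κ * runSup h ω₂) h + h ^ 2 + |stepDriverK κ ω₂ h| ^ 3 + h * |stepDriverK κ ω₂ h|) := by
  obtain ⟨hh32', hh32, -, hh1, -, -, -⟩ := frozen_smallnessK (u := u) hκ0 hκ hρ₀ hρ1 hδ0 hδ hh
  set υ := concat u (stop u (brownianCPath ω), brownianCPath ω₂) with hυ
  set B := slidHull (drvK κ (brownianCPath ω)) A u with hBdef
  have hB : IsStarHull B := Loewner.isStarHull_slidHull_of_disjoint (continuous_drvK κ _) hA halive
  have hBρ8 : Disjoint (ball (0 : ℂ) (8 * ρ₀)) B := hBρ.mono_left (ball_subset_ball (by linarith))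
  obtain ⟨hd0, hd1, -⟩ := starDeriv_spec hB
  have hδ' : δ₀ ≤ starDeriv B := by linarith
  obtain ⟨-, -, hc2, hc3, -⟩ := starJet_spec hB hρ₀ hBρ8
  obtain ⟨hω₂K, hsS, hϱ⟩ := goodEvent_subset_goodEventK hκ0 hκ δ₀ ρ₀ h hω₂
  set x : ℝ := stepDriverK κ ω₂ h with hx
  set rκ : ℝ := h * stepSize (Real.sqrt κ * runSup h ω₂) h + h ^ 2 + |x| ^ 3 + h * |x| with hrκ
  -- the `W̃`-side
  obtain ⟨-, hZeq⟩ := imageDrvFnK_concat_sub_eq_of_mem_goodEventK (κ := κ) hA halive hρ₀ hρ1 hBρ8 hδ0 hδ' hh0 hh32 hω₂K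
  have hM := abs_imageDriverStep_sub_model_le_of_mem_goodEventK hB hρ₀ hρ1 hBρ8 hδ0 hδ' hh0 hh32 hω₂K
  -- the `Y`-side
  obtain ⟨hDeq, -⟩ := DFnK_MFnK_concat_eq_of_good hκ hA halive hρ₀ hBρ hδ0 hδ hh0 hh32' hω₂
  obtain ⟨hJ0, hJM, hJΔ⟩ := JFnK_concat_bounds hκ hA halive hρ₀ hBρ hδ0 hδ hh0 hh32' hne hω₂
  obtain ⟨hUc, hU0⟩ := continuous_stepDriverK κ ω₂
  set S : ℝ := stepSigma * runSup h ω₂ with hSdef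
  have hSU : ∀ v : ℝ≥0, v ≤ h → |stepDriverK κ ω₂ v| ≤ S := fun v hv ↦ abs_stepDriverK_le hκ hv ω₂
  have hω₂' : S ≤ δ₀ * ρ₀ / 4000 := hω₂
  obtain ⟨hc0, hc1, h4, -, -, -⟩ := step_smallness hB hρ₀ hρ1 hδ0 hδ' hh32'
  have hη2 : stepSize S h ≤ 2 * (δ₀ * ρ₀ / 4000) := by rw [stepSize]; linarith
  have hη : stepSize S h ≤ starDeriv B * ρ₀ / 1000 := by
    refine hη2.trans ?_
    rw [show 2 * (δ₀ * ρ₀ / 4000) = δ₀ * ρ₀ / 2000 by ring, div_le_div_iff₀ (by norm_num) (by norm_num)]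
    nlinarith [mul_le_mul_of_nonneg_right hδ' hρ₀.le]
  have hη1 : stepSize S h ≤ 1 := by linarith
  have key := abs_compensatedStep_le hB hUc hU0 hh0 hSU hρ₀ hBρ8 hη hα' hlam' hρ1 hδ0 hδ' hη1 hh1 hlamh hJ0 hJM hJΔ
  -- the step sizes compare
  have hS0 : 0 ≤ stepSize (Real.sqrt κ * runSup h ω₂) h := by
    rw [stepSize]; have := runSup_nonneg h ω₂; positivity
  have hrκ0 : 0 ≤ rκ := by rw [hrκ]; positivity
  have hrcomp : (h : ℝ) * stepSize S h + h ^ 2 + |x| ^ 3 + h * |x| ≤ stepSigma / Real.sqrt κ * rκ := by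
    have h1 : (h : ℝ) * stepSize S h ≤ stepSigma / Real.sqrt κ * (h * stepSize (Real.sqrt κ * runSup h ω₂) h) := by
      have := mul_le_mul_of_nonneg_left hsS h.coe_nonneg
      linarith
    have h2 : (h : ℝ) ^ 2 + |x| ^ 3 + h * |x| ≤ stepSigma / Real.sqrt κ * (h ^ 2 + |x| ^ 3 + h * |x|) := by
      have h0 : 0 ≤ (h : ℝ) ^ 2 + |x| ^ 3 + h * |x| := by positivity
      nlinarith
    have : stepSigma / Real.sqrt κ * rκ = stepSigma / Real.sqrt κ * (h * stepSize (Real.sqrt κ * runSup h ω₂) h) +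
        stepSigma / Real.sqrt κ * (h ^ 2 + |x| ^ 3 + h * |x|) := by rw [hrκ]; ring
    linarith
  have hcompK0 : 0 ≤ compK α' lam' δ₀ ρ₀ := (compK_pos hα' hlam' hδ0 hρ₀).le
  have hY : |starDeriv (slidHull (stepDriverK κ ω₂) B h) ^ α' * Real.exp (-(lam' * JFnK κ A u h υ)) - starDeriv B ^ α' -
      (stepModelK α' (starDeriv B) (starJet2 B) (starJet3 B) h x -
        lam' * h * bubbleMass (starDeriv B) (starJet2 B / 2) (starJet3 B / 6) * starDeriv B ^ α')| ≤
      compK α' lam' δ₀ ρ₀ * (stepSigma / Real.sqrt κ) * rκ := by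
    refine key.trans ?_
    rw [mul_assoc]
    exact mul_le_mul_of_nonneg_left hrcomp hcompK0
  -- the hypotheses of the product expansion
  have hx1 : |x| ≤ 1 := (abs_le_of_mem_goodEventK hω₂K).1.trans (hc1.trans (by norm_num))
  have hm : |bubbleMass (starDeriv B) (starJet2 B / 2) (starJet3 B / 6)| ≤ massBound δ₀ ρ₀ := by
    rw [massBound]; exact abs_schwarzMass_le hδ0 hρ₀ hδ' hc2 hc3
  have hYh01 : 0 ≤ DFnK κ A (u + h) υ ^ α' * Real.exp (-(lam' * JFnK κ A u h υ)) ∧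
      DFnK κ A (u + h) υ ^ α' * Real.exp (-(lam' * JFnK κ A u h υ)) ≤ 1 := by
    obtain ⟨-, -, h0, h1⟩ := DFnK_eq (κ := κ) (A := A) (u + h) υ
    have e0 : 0 ≤ DFnK κ A (u + h) υ ^ α' := Real.rpow_nonneg h0 _
    have e1 : DFnK κ A (u + h) υ ^ α' ≤ 1 := Real.rpow_le_one h0 h1 hα'.le
    have c0 : 0 < Real.exp (-(lam' * JFnK κ A u h υ)) := Real.exp_pos _
    have c1 : Real.exp (-(lam' * JFnK κ A u h υ)) ≤ 1 := by
      rw [Real.exp_le_one_iff, neg_nonpos]; exact mul_nonneg hlam' (JFnK_nonneg hA u h υ)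
    exact ⟨mul_nonneg e0 c0.le, mul_le_one₀ e1 c0.le c1⟩
  have hA0 : 0 ≤ (h : ℝ) * stepSize (Real.sqrt κ * runSup h ω₂) h := mul_nonneg h.coe_nonneg hS0
  have hB0 : 0 ≤ (h : ℝ) ^ 2 := sq_nonneg _
  have hC0 : 0 ≤ |x| ^ 3 := pow_nonneg (abs_nonneg x) 3
  have hD0 : 0 ≤ (h : ℝ) * |x| := mul_nonneg h.coe_nonneg (abs_nonneg x)
  have hr2 : (h : ℝ) ^ 2 ≤ rκ := by rw [hrκ]; linarith
  have hr3 : |x| ^ 3 ≤ rκ := by rw [hrκ]; linarith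
  have hrx : (h : ℝ) * |x| ≤ rκ := by rw [hrκ]; linarith
  rw [hDeq] at hYh01
  rw [hZeq, hDeq]
  exact hK hδ' hd1 hc2 hc3 hm hx1 hh1 hYh01.1 hYh01.2 hr2 hr3 hrx hM hY

omit [MeasurableSpace C(ℝ≥0, ℝ)] [BorelSpace C(ℝ≥0, ℝ)] in
include hA hR0 hAR hρ₀ hN0 hN in
/-- **The product everywhere** (the bad-event envelope): for `h ≤ 1`, `α′ > 0`, `λ′ ≥ 0`,
`|ΔW̃ · Ŷ′ − 6α′ d^{α′} c₂ h| ≤ (3482 N + 15080 √(u+h) + 1160 R + 6α′/ρ₀) + 3482 √κ sup_{[0,h]}|B(ω₂)|`. [folklore] -/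
theorem frozen_prod_bad {α' lam' : ℝ} (hα' : 0 < α') (hlam' : 0 ≤ lam') (hh1 : (h : ℝ) ≤ 1)
    (hal : Disjoint (closedHull (drvK κ (brownianCPath ω)) u) A)
    (hBρ8 : Disjoint (ball (0 : ℂ) (8 * ρ₀)) (slidHull (drvK κ (brownianCPath ω)) A u)) (ω₂ : ℝ≥0 → ℝ) :
    |(imageDrvFnK κ A (u + h) (concat u (stop u (brownianCPath ω), brownianCPath ω₂)) -
            imageDrvFnK κ A u (concat u (stop u (brownianCPath ω), brownianCPath ω₂))) *
          (DFnK κ A (u + h) (concat u (stop u (brownianCPath ω), brownianCPath ω₂)) ^ α' *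
            Real.exp (-(lam' * JFnK κ A u h (concat u (stop u (brownianCPath ω), brownianCPath ω₂))))) -
        6 * α' * starDeriv (slidHull (drvK κ (brownianCPath ω)) A u) ^ α' * starJet2 (slidHull (drvK κ (brownianCPath ω)) A u) * h| ≤
      (3482 * N + (15080 * Real.sqrt ((u + h : ℝ≥0) : ℝ) + 1160 * R) + 6 * α' / ρ₀) + 3482 * Real.sqrt κ * runSup h ω₂ := by
  set υ := concat u (stop u (brownianCPath ω), brownianCPath ω₂) with hυ
  set B := slidHull (drvK κ (brownianCPath ω)) A u with hBdef
  have hB : IsStarHull B := Loewner.isStarHull_slidHull_of_disjoint (continuous_drvK κ _) hA hal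
  obtain ⟨hd0, hd1, -⟩ := starDeriv_spec hB
  obtain ⟨-, -, hc2, -, -⟩ := starJet_spec hB hρ₀ hBρ8
  have hZ := abs_imageDrvFnK_concat_sub_le_of_abs_le (κ := κ) (h := h) hA hR0 hAR hN0 hN ω₂
  have hYh01 : 0 ≤ DFnK κ A (u + h) υ ^ α' * Real.exp (-(lam' * JFnK κ A u h υ)) ∧
      DFnK κ A (u + h) υ ^ α' * Real.exp (-(lam' * JFnK κ A u h υ)) ≤ 1 := by
    obtain ⟨-, -, h0, h1⟩ := DFnK_eq (κ := κ) (A := A) (u + h) υ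
    have e0 : 0 ≤ DFnK κ A (u + h) υ ^ α' := Real.rpow_nonneg h0 _
    have e1 : DFnK κ A (u + h) υ ^ α' ≤ 1 := Real.rpow_le_one h0 h1 hα'.le
    have c0 : 0 < Real.exp (-(lam' * JFnK κ A u h υ)) := Real.exp_pos _
    have c1 : Real.exp (-(lam' * JFnK κ A u h υ)) ≤ 1 := by
      rw [Real.exp_le_one_iff, neg_nonpos]; exact mul_nonneg hlam' (JFnK_nonneg hA u h υ)
    exact ⟨mul_nonneg e0 c0.le, mul_le_one₀ e1 c0.le c1⟩
  have hy0 : 0 ≤ starDeriv B ^ α' := Real.rpow_nonneg hd0.le _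
  have hy1 : starDeriv B ^ α' ≤ 1 := Real.rpow_le_one hd0.le hd1 hα'.le
  have hs : |6 * α' * starDeriv B ^ α' * starJet2 B * h| ≤ 6 * α' / ρ₀ := by
    rw [abs_mul, abs_mul, abs_mul, abs_of_nonneg h.coe_nonneg, abs_of_nonneg hy0,
      abs_of_nonneg (by positivity : (0 : ℝ) ≤ 6 * α')]
    have h1 : 6 * α' * starDeriv B ^ α' * |starJet2 B| ≤ 6 * α' * 1 * (1 / ρ₀) :=
      mul_le_mul (mul_le_mul_of_nonneg_left hy1 (by positivity)) hc2 (abs_nonneg _) (by positivity)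
    have h2 : 0 ≤ 6 * α' * starDeriv B ^ α' * |starJet2 B| := by positivity
    calc _ ≤ 6 * α' * 1 * (1 / ρ₀) * 1 := mul_le_mul h1 hh1 h.coe_nonneg (by positivity)
      _ = 6 * α' / ρ₀ := by ring
  have hprod : |(imageDrvFnK κ A (u + h) υ - imageDrvFnK κ A u υ) * (DFnK κ A (u + h) υ ^ α' * Real.exp (-(lam' * JFnK κ A u h υ)))| ≤
      (3482 * N + (15080 * Real.sqrt ((u + h : ℝ≥0) : ℝ) + 1160 * R)) + 3482 * Real.sqrt κ * runSup h ω₂ := by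
    rw [abs_mul, abs_of_nonneg hYh01.1]
    exact (mul_le_of_le_one_right (abs_nonneg _) hYh01.2).trans hZ
  calc _ ≤ |(imageDrvFnK κ A (u + h) υ - imageDrvFnK κ A u υ) * (DFnK κ A (u + h) υ ^ α' * Real.exp (-(lam' * JFnK κ A u h υ)))| +
        |6 * α' * starDeriv B ^ α' * starJet2 B * h| := abs_sub _ _
    _ ≤ _ := by linarith

include hA hne in
/-- Measurability of the frozen product in the future `ω₂`. [folklore] -/
theorem measurable_frozen_prod (α' lam' s : ℝ) :
    Measurable fun ω₂ : ℝ≥0 → ℝ ↦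
      (imageDrvFnK κ A (u + h) (concat u (stop u (brownianCPath ω), brownianCPath ω₂)) -
            imageDrvFnK κ A u (concat u (stop u (brownianCPath ω), brownianCPath ω₂))) *
          (DFnK κ A (u + h) (concat u (stop u (brownianCPath ω), brownianCPath ω₂)) ^ α' *
            Real.exp (-(lam' * JFnK κ A u h (concat u (stop u (brownianCPath ω), brownianCPath ω₂))))) - s := by
  have hc : Measurable fun ω₂ : ℝ≥0 → ℝ ↦ concat u (stop u (brownianCPath ω), brownianCPath ω₂) :=
    (measurable_concat u).comp (measurable_const.prodMk measurable_brownianCPath)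
  have h1 : Measurable fun υ : C(ℝ≥0, ℝ) ↦ imageDrvFnK κ A (u + h) υ - imageDrvFnK κ A u υ :=
    (measurable_imageDrvFnK κ hA hne _).sub (measurable_imageDrvFnK κ hA hne _)
  have h2 : Measurable fun υ : C(ℝ≥0, ℝ) ↦ DFnK κ A (u + h) υ ^ α' * Real.exp (-(lam' * JFnK κ A u h υ)) :=
    ((measurable_DFnK hA hne (u + h)).pow_const _).mul ((measurable_JFnK hA hne u h).const_mul lam').neg.exp
  exact ((h1.comp hc).mul (h2.comp hc)).sub measurable_const

include hκ0 hκ hA hne hR0 hAR halive hρ₀ hρ1 hBρ hδ0 hδ hh0 hh hN0 hN in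
/-- **The frozen first moment of the product** ([LSW] §5 (5.1)–(5.3) with Prop. 5.3, one step,
conditionally on the past): for `α′ > 0`, `λ′ ≥ 0`, `λ′ h M_m ≤ 1`,

  `|E_{ω₂}[ΔW̃ · Ŷ′] − h · d^{α′} c₂ (κ/2 − 3 + κ α′)| ≤ imageStepC κ c (d·d^{α′}) (d^{α′}c₂(1+2α′)) K (M₀ + 6α′/ρ₀) M₁ · h√h`

(`c = c₀√κ/σ`, `K` the constant of `frozen_prod_good`, `M₀ = 3482N + 15080√(u+h) + 1160R`, `M₁ = 3482√κ`).
For `α′ = (6 − κ)/(2κ)` the first-order coefficient `κ/2 − 3 + κα′` vanishes.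
[cite: LawlerSchrammWerner2003Restriction, §5 (5.1)–(5.3) and Prop. 5.3] -/
theorem frozen_prod_integral_sub_le {α' lam' : ℝ} (hα' : 0 < α') (hlam' : 0 ≤ lam') (hlamh : lam' * (h * massBound δ₀ ρ₀) ≤ 1)
    {K : ℝ} (hK0 : 0 ≤ K)
    (hK : ∀ {d c₂ c₃ m x ZM Yh r : ℝ} {u : ℝ≥0}, δ₀ ≤ d → d ≤ 1 →
      |c₂| ≤ 1 / ρ₀ → |c₃| ≤ 2 / ρ₀ ^ 2 → |m| ≤ massBound δ₀ ρ₀ → |x| ≤ 1 → (u : ℝ) ≤ 1 → 0 ≤ Yh → Yh ≤ 1 →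
      (u : ℝ) ^ 2 ≤ r → |x| ^ 3 ≤ r → u * |x| ≤ r →
      |ZM - imageDriverModel d c₂ u x| ≤ stepK δ₀ ρ₀ * r →
      |Yh - d ^ α' - (stepModelK α' d c₂ c₃ u x - lam' * u * m * d ^ α')| ≤ compK α' lam' δ₀ ρ₀ * (stepSigma / Real.sqrt κ) * r →
      |ZM * Yh - 6 * α' * d ^ α' * c₂ * u - imageDriverModel (d * d ^ α') (d ^ α' * c₂ * (1 + 2 * α')) u x| ≤ K * r) :
    |∫ ω₂, (imageDrvFnK κ A (u + h) (concat u (stop u (brownianCPath ω), brownianCPath ω₂)) -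
            imageDrvFnK κ A u (concat u (stop u (brownianCPath ω), brownianCPath ω₂))) *
          (DFnK κ A (u + h) (concat u (stop u (brownianCPath ω), brownianCPath ω₂)) ^ α' *
            Real.exp (-(lam' * JFnK κ A u h (concat u (stop u (brownianCPath ω), brownianCPath ω₂))))) ∂preWienerMeasure -
        h * (starDeriv (slidHull (drvK κ (brownianCPath ω)) A u) ^ α' * starJet2 (slidHull (drvK κ (brownianCPath ω)) A u) *
          ((κ : ℝ) / 2 - 3 + κ * α'))| ≤
      imageStepC κ (δ₀ * ρ₀ / 4000 * (Real.sqrt κ / stepSigma))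
          (starDeriv (slidHull (drvK κ (brownianCPath ω)) A u) * starDeriv (slidHull (drvK κ (brownianCPath ω)) A u) ^ α')
          (starDeriv (slidHull (drvK κ (brownianCPath ω)) A u) ^ α' * starJet2 (slidHull (drvK κ (brownianCPath ω)) A u) * (1 + 2 * α'))
          (K)
          ((3482 * N + (15080 * Real.sqrt ((u + h : ℝ≥0) : ℝ) + 1160 * R) + 6 * α' / ρ₀)) (3482 * Real.sqrt κ) *
        h * Real.sqrt h := by
  haveI := isProbabilityMeasure_preWienerMeasure'
  obtain ⟨-, -, hhκ, hh1, hc0, -, -⟩ := frozen_smallnessK (u := u) hκ0 hκ hρ₀ hρ1 hδ0 hδ hh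
  set B := slidHull (drvK κ (brownianCPath ω)) A u with hBdef
  have hBρ8 : Disjoint (ball (0 : ℂ) (8 * ρ₀)) B := hBρ.mono_left (ball_subset_ball (by linarith))
  set d : ℝ := starDeriv B with hd
  set c₂ : ℝ := starJet2 B with hc₂
  set s : ℝ := 6 * α' * d ^ α' * c₂ * h with hs
  set Z : (ℝ≥0 → ℝ) → ℝ := fun ω₂ ↦ (imageDrvFnK κ A (u + h) (concat u (stop u (brownianCPath ω), brownianCPath ω₂)) -
      imageDrvFnK κ A u (concat u (stop u (brownianCPath ω), brownianCPath ω₂))) *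
    (DFnK κ A (u + h) (concat u (stop u (brownianCPath ω), brownianCPath ω₂)) ^ α' *
      Real.exp (-(lam' * JFnK κ A u h (concat u (stop u (brownianCPath ω), brownianCPath ω₂))))) with hZ
  have hKP : 0 ≤ K := hK0
  have hM₀ : 0 ≤ (3482 * N + (15080 * Real.sqrt ((u + h : ℝ≥0) : ℝ) + 1160 * R) + 6 * α' / ρ₀) := by positivity
  have hM₁ : (0 : ℝ) ≤ 3482 * Real.sqrt κ := by positivity
  have hZm : Measurable fun ω₂ ↦ Z ω₂ - s := measurable_frozen_prod (u := u) (h := h) (ω := ω) hA hne α' lam' s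
  have hbad : ∀ ω₂, |Z ω₂ - s| ≤ (3482 * N + (15080 * Real.sqrt ((u + h : ℝ≥0) : ℝ) + 1160 * R) + 6 * α' / ρ₀) +
      3482 * Real.sqrt κ * runSup h ω₂ := fun ω₂ ↦
    frozen_prod_bad (u := u) hA hR0 hAR hρ₀ hN0 hN hα' hlam' hh1 halive hBρ8 ω₂
  have hgood : ∀ ω₂ ∈ goodEventK κ (δ₀ * ρ₀ / 4000 * (Real.sqrt κ / stepSigma)) h,
      |Z ω₂ - s - imageDriverModel (d * d ^ α') (d ^ α' * c₂ * (1 + 2 * α')) h (stepDriverK κ ω₂ h)| ≤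
        K *
          (h * stepSize (Real.sqrt κ * runSup h ω₂) h + h ^ 2 + |stepDriverK κ ω₂ h| ^ 3 + h * |stepDriverK κ ω₂ h|) := by
    intro ω₂ hω₂
    rw [goodEventK_eq_goodEvent hκ0] at hω₂
    exact frozen_prod_good hκ0 hκ hA hne halive hρ₀ hρ1 hBρ hδ0 hδ hh0 hh hα' hlam' hlamh hK hω₂
  have key := abs_integral_sub_drift_le hκ0 hc0 hhκ hh1 hKP hM₀ hM₁ hZm hgood hbad
  -- `∫ (Z − s) = ∫ Z − s`
  have hbadZ : ∀ ω₂, |Z ω₂| ≤ ((3482 * N + (15080 * Real.sqrt ((u + h : ℝ≥0) : ℝ) + 1160 * R) + 6 * α' / ρ₀) + |s|) +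
      3482 * Real.sqrt κ * runSup h ω₂ := fun ω₂ ↦ by
    have h1 := hbad ω₂
    have h2 : |Z ω₂| ≤ |Z ω₂ - s| + |s| := by
      have := abs_add_le (Z ω₂ - s) s; rwa [sub_add_cancel] at this
    linarith
  have hZm' : Measurable Z := by
    have := hZm.add_const s; simpa using this
  have iZ : Integrable Z preWienerMeasure := integrable_of_abs_le_runSup (h := h) hZm' hbadZ
  have hint : ∫ ω₂, (Z ω₂ - s) ∂preWienerMeasure = ∫ ω₂, Z ω₂ ∂preWienerMeasure - s := by
    rw [integral_sub iZ (integrable_const s), integral_const]; simp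
  rw [hint] at key
  have hdrift : s + h * imageDriverDrift κ (d ^ α' * c₂ * (1 + 2 * α')) = h * (d ^ α' * c₂ * ((κ : ℝ) / 2 - 3 + κ * α')) := by
    rw [hs, imageDriverDrift]; ring
  have : ∫ ω₂, Z ω₂ ∂preWienerMeasure - s - h * imageDriverDrift κ (d ^ α' * c₂ * (1 + 2 * α')) =
      ∫ ω₂, Z ω₂ ∂preWienerMeasure - h * (d ^ α' * c₂ * ((κ : ℝ) / 2 - 3 + κ * α')) := by rw [← hdrift]; ring
  rw [this] at key
  exact key

include hκ0 hκ hA hne hR0 hAR halive hρ₀ hρ1 hBρ hδ0 hδ hh0 hh hN0 hN in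
/-- **The frozen second moment of the product**: for `α′ > 0`, `λ′ ≥ 0`, `λ′ h M_m ≤ 1`,

  `|E_{ω₂}[(ΔW̃ · Ŷ′ − 6α′d^{α′}c₂h)²] − κ (d · d^{α′})² h| ≤ imageStepC₂ κ c (d·d^{α′}) (d^{α′}c₂(1+2α′)) K (M₀ + 6α′/ρ₀) M₁ · h√h`

(`abs_integral_sq_sub_le`). With `(α′, λ′) = (α/2, λ/2)` this is the conditional second moment
`E[(ΔW̃)² Ŷ′_{α,λ}] ≈ κ d² d^α h` behind the bracket identity `((W̃)² − κ∫h′²) · Y`.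
[cite: LawlerSchrammWerner2003Restriction, §5 (5.1)–(5.3) and Prop. 5.3] -/
theorem frozen_prod_sq_integral_sub_le {α' lam' : ℝ} (hα' : 0 < α') (hlam' : 0 ≤ lam') (hlamh : lam' * (h * massBound δ₀ ρ₀) ≤ 1)
    {K : ℝ} (hK0 : 0 ≤ K)
    (hK : ∀ {d c₂ c₃ m x ZM Yh r : ℝ} {u : ℝ≥0}, δ₀ ≤ d → d ≤ 1 →
      |c₂| ≤ 1 / ρ₀ → |c₃| ≤ 2 / ρ₀ ^ 2 → |m| ≤ massBound δ₀ ρ₀ → |x| ≤ 1 → (u : ℝ) ≤ 1 → 0 ≤ Yh → Yh ≤ 1 →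
      (u : ℝ) ^ 2 ≤ r → |x| ^ 3 ≤ r → u * |x| ≤ r →
      |ZM - imageDriverModel d c₂ u x| ≤ stepK δ₀ ρ₀ * r →
      |Yh - d ^ α' - (stepModelK α' d c₂ c₃ u x - lam' * u * m * d ^ α')| ≤ compK α' lam' δ₀ ρ₀ * (stepSigma / Real.sqrt κ) * r →
      |ZM * Yh - 6 * α' * d ^ α' * c₂ * u - imageDriverModel (d * d ^ α') (d ^ α' * c₂ * (1 + 2 * α')) u x| ≤ K * r) :
    |∫ ω₂, ((imageDrvFnK κ A (u + h) (concat u (stop u (brownianCPath ω), brownianCPath ω₂)) -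
            imageDrvFnK κ A u (concat u (stop u (brownianCPath ω), brownianCPath ω₂))) *
          (DFnK κ A (u + h) (concat u (stop u (brownianCPath ω), brownianCPath ω₂)) ^ α' *
            Real.exp (-(lam' * JFnK κ A u h (concat u (stop u (brownianCPath ω), brownianCPath ω₂))))) -
          6 * α' * starDeriv (slidHull (drvK κ (brownianCPath ω)) A u) ^ α' * starJet2 (slidHull (drvK κ (brownianCPath ω)) A u) * h) ^ 2
          ∂preWienerMeasure -
        κ * (starDeriv (slidHull (drvK κ (brownianCPath ω)) A u) * starDeriv (slidHull (drvK κ (brownianCPath ω)) A u) ^ α') ^ 2 * h| ≤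
      imageStepC₂ κ (δ₀ * ρ₀ / 4000 * (Real.sqrt κ / stepSigma))
          (starDeriv (slidHull (drvK κ (brownianCPath ω)) A u) * starDeriv (slidHull (drvK κ (brownianCPath ω)) A u) ^ α')
          (starDeriv (slidHull (drvK κ (brownianCPath ω)) A u) ^ α' * starJet2 (slidHull (drvK κ (brownianCPath ω)) A u) * (1 + 2 * α'))
          (K)
          ((3482 * N + (15080 * Real.sqrt ((u + h : ℝ≥0) : ℝ) + 1160 * R) + 6 * α' / ρ₀)) (3482 * Real.sqrt κ) *
        h * Real.sqrt h := by
  obtain ⟨-, -, hhκ, hh1, hc0, hc1, -⟩ := frozen_smallnessK (u := u) hκ0 hκ hρ₀ hρ1 hδ0 hδ hh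
  set B := slidHull (drvK κ (brownianCPath ω)) A u with hBdef
  have hBρ8 : Disjoint (ball (0 : ℂ) (8 * ρ₀)) B := hBρ.mono_left (ball_subset_ball (by linarith))
  set d : ℝ := starDeriv B with hd
  set c₂ : ℝ := starJet2 B with hc₂
  set s : ℝ := 6 * α' * d ^ α' * c₂ * h with hs
  set Z : (ℝ≥0 → ℝ) → ℝ := fun ω₂ ↦ (imageDrvFnK κ A (u + h) (concat u (stop u (brownianCPath ω), brownianCPath ω₂)) -
      imageDrvFnK κ A u (concat u (stop u (brownianCPath ω), brownianCPath ω₂))) *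
    (DFnK κ A (u + h) (concat u (stop u (brownianCPath ω), brownianCPath ω₂)) ^ α' *
      Real.exp (-(lam' * JFnK κ A u h (concat u (stop u (brownianCPath ω), brownianCPath ω₂))))) with hZ
  have hKP : 0 ≤ K := hK0
  have hM₀ : 0 ≤ (3482 * N + (15080 * Real.sqrt ((u + h : ℝ≥0) : ℝ) + 1160 * R) + 6 * α' / ρ₀) := by positivity
  have hM₁ : (0 : ℝ) ≤ 3482 * Real.sqrt κ := by positivity
  have hZm : Measurable fun ω₂ ↦ Z ω₂ - s := measurable_frozen_prod (u := u) (h := h) (ω := ω) hA hne α' lam' s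
  have hbad : ∀ ω₂, |Z ω₂ - s| ≤ (3482 * N + (15080 * Real.sqrt ((u + h : ℝ≥0) : ℝ) + 1160 * R) + 6 * α' / ρ₀) +
      3482 * Real.sqrt κ * runSup h ω₂ := fun ω₂ ↦
    frozen_prod_bad (u := u) hA hR0 hAR hρ₀ hN0 hN hα' hlam' hh1 halive hBρ8 ω₂
  have hgood : ∀ ω₂ ∈ goodEventK κ (δ₀ * ρ₀ / 4000 * (Real.sqrt κ / stepSigma)) h,
      |Z ω₂ - s - imageDriverModel (d * d ^ α') (d ^ α' * c₂ * (1 + 2 * α')) h (stepDriverK κ ω₂ h)| ≤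
        K *
          (h * stepSize (Real.sqrt κ * runSup h ω₂) h + h ^ 2 + |stepDriverK κ ω₂ h| ^ 3 + h * |stepDriverK κ ω₂ h|) := by
    intro ω₂ hω₂
    rw [goodEventK_eq_goodEvent hκ0] at hω₂
    exact frozen_prod_good hκ0 hκ hA hne halive hρ₀ hρ1 hBρ hδ0 hδ hh0 hh hα' hlam' hlamh hK hω₂
  exact abs_integral_sq_sub_le hκ0 hc0 hc1 hhκ hh1 hKP hM₀ hM₁ hZm hgood hbad

end Frozen

section Registered
omit [MeasurableSpace C(ℝ≥0, ℝ)] [BorelSpace C(ℝ≥0, ℝ)] in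
/-- **Registered form** (explicit binders) of `frozen_smallnessK`: `32κh ≤ c²` and `h ≤ 1`. [folklore] -/
theorem frozen_smallnessK_registered :
    ∀ (κ : ℝ≥0) (A : Set ℂ) (u h : ℝ≥0) (ω : ℝ≥0 → ℝ) (δ₀ ρ₀ : ℝ), 0 < κ → κ ≤ 8 / 3 → 0 < ρ₀ → ρ₀ ≤ 1 →
      0 < δ₀ → 2 * δ₀ ≤ starDeriv (Loewner.slidHull (drvK κ (brownianCPath ω)) A u) →
      (h : ℝ) ≤ 3 * (δ₀ * ρ₀ / 4000) ^ 2 / 256 →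
      32 * (κ : ℝ) * h ≤ (δ₀ * ρ₀ / 4000 * (Real.sqrt κ / stepSigma)) ^ 2 ∧ (h : ℝ) ≤ 1 := by
  intro κ A u h ω δ₀ ρ₀ hκ0 hκ hρ₀ hρ1 hδ0 hδ hh
  exact ⟨(frozen_smallnessK (u := u) hκ0 hκ hρ₀ hρ1 hδ0 hδ hh).2.2.1, (frozen_smallnessK (u := u) hκ0 hκ hρ₀ hρ1 hδ0 hδ hh).2.2.2.1⟩

end Registered

end Summit.CriticalPhenomena.SAWScalingLimit.Theorems.SubseqIdentification.BoundaryAreaLaw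

end
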